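import Literature.NumberTheory.Transcendental.CuspValueAlgebraicCoeff
import Literature.NumberTheory.Transcendental.CuspSlopeAlgebraic
import HarnessLib

/-!
# The asymptotic constant `lim (v − βu)` on a ℚ-relation is algebraic

Third companion of `CuspValueAlgebraic` / `CuspSlopeAlgebraic`: let `P ∈ ℚ[Y][X]` be nonzero,
`β` algebraic, and `(u_n, v_n)` complex solutions of `P(u_n, v_n) = 0` with `|u_n| → ∞` and
`v_n − β u_n → γ`. Then `γ` is algebraic (`isAlgebraic_of_tendsto_sub_mul_of_eval₂_eq_zero`): the
substitution `Y ↦ βX + Y` produces a nonzero polynomial `P̃(X, Y) = P(X, βX + Y)` with ALGEBRAIC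
coefficients and `P̃(u_n, v_n − βu_n) = 0`, to which the algebraic-coefficient value lemma
`isAlgebraic_of_tendsto_of_eval₂_eq_zero_of_coeff` applies. For a LINEAR cusp of a ℚ-curve with
slope `β` this identifies the constant `γ₀ = 2πi·a₀ + ℓ_v(0) − β ℓ_u(0)` of the normal form as an
algebraic number (crux `RigidCore.SparsityTwo`, line cusp-germ-schneider-sparsity, stub (★)).
[folklore]
-/

noncomputable section

open Filter Polynomial
open _root_.Topology

namespace Literature.NumberTheory.Transcendental

/-- Coefficients of a polynomial mapped from the algebraic closure of `ℚ` in `ℂ` are algebraic.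
[folklore] -/
theorem isAlgebraic_coeff_coeff_map_map (Q : Polynomial (Polynomial (algebraicClosure ℚ ℂ)))
    (i j : ℕ) :
    IsAlgebraic ℚ (((Q.map (mapRingHom (algebraMap (algebraicClosure ℚ ℂ) ℂ))).coeff i).coeff j) := by
  rw [coeff_map, coe_mapRingHom, coeff_map]
  exact mem_algebraicClosure_iff.mp ((Q.coeff i).coeff j).2

/-- **The asymptotic constant is algebraic.** Let `P ∈ ℚ[Y][X]` be nonzero, `β ∈ ℂ` algebraic,
and `u v : ℕ → ℂ` with `‖u n‖ → ∞`, `v n − β u n → γ` and `P(u n, v n) = 0` for all `n`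
(evaluation as in `CuspValueAlgebraic`). Then `γ` is algebraic over `ℚ`. [folklore] -/
theorem isAlgebraic_of_tendsto_sub_mul_of_eval₂_eq_zero (P : Polynomial (Polynomial ℚ))
    (hP : P ≠ 0) {β : ℂ} (hβ : IsAlgebraic ℚ β) {u v : ℕ → ℂ} {γ : ℂ}
    (hu : Tendsto (fun n => ‖u n‖) atTop atTop)
    (hγ : Tendsto (fun n => v n - β * u n) atTop (𝓝 γ))
    (h : ∀ n, (P.map (mapRingHom (algebraMap ℚ ℂ))).eval₂ (evalRingHom (v n)) (u n) = 0) :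
    IsAlgebraic ℚ γ := by
  set L := algebraicClosure ℚ ℂ with hL
  set βL : L := ⟨β, mem_algebraicClosure_iff.mpr hβ⟩ with hβL
  -- the substitution `Y ↦ βX + Y`, over `L`
  let φ : Polynomial ℚ →+* Polynomial (Polynomial L) :=
    eval₂RingHom ((C : Polynomial L →+* Polynomial (Polynomial L)).comp
      ((C : L →+* Polynomial L).comp (algebraMap ℚ L))) (C (C βL) * X + C X)
  let S : Polynomial (Polynomial ℚ) →+* Polynomial (Polynomial L) := eval₂RingHom φ X
  set Q : Polynomial (Polynomial ℂ) := (S P).map (mapRingHom (algebraMap L ℂ)) with hQ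
  -- complex evaluation functionals
  let ev : ℂ → ℂ → (Polynomial (Polynomial ℂ) →+* ℂ) := fun x y => eval₂RingHom (evalRingHom y) x
  let evQ : ℂ → ℂ → (Polynomial (Polynomial ℚ) →+* ℂ) := fun x y =>
    eval₂RingHom (eval₂RingHom (algebraMap ℚ ℂ) y) x
  have hevQ : ∀ x y (R : Polynomial (Polynomial ℚ)),
      (R.map (mapRingHom (algebraMap ℚ ℂ))).eval₂ (evalRingHom y) x = evQ x y R := by
    intro x y R
    exact (evalBivariate_eq x y R).symm
  -- the evaluation identity `Q(x, w) = P(x, βx + w)`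
  have hsubst : ∀ x w : ℂ, ev x w Q = evQ x (β * x + w) P := by
    intro x w
    rw [hQ]
    change ((ev x w).comp ((mapRingHom (mapRingHom (algebraMap L ℂ))).comp S)) P = evQ x (β * x + w) P
    congr 1
    refine Polynomial.ringHom_ext (fun c => ?_) ?_
    · -- constants `c ∈ ℚ[Y]`
      have h1 : S (C c) = φ c := by simp [S]
      have h2 : (evQ x (β * x + w)) (C c) = eval₂RingHom (algebraMap ℚ ℂ) (β * x + w) c := by
        simp [evQ]
      rw [RingHom.comp_apply, RingHom.comp_apply, h1, h2]
      change (((ev x w).comp (mapRingHom (mapRingHom (algebraMap L ℂ)))).comp φ) c =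
        (eval₂RingHom (algebraMap ℚ ℂ) (β * x + w)) c
      congr 1
      refine Polynomial.ringHom_ext (fun a => ?_) ?_
      · simp [ev, φ]
      · simp [ev, φ, hβL]
    · simp [ev, evQ, S]
  -- `Q ≠ 0`
  have hQ0 : Q ≠ 0 := by
    intro h0
    apply hP
    apply eq_zero_of_forall_evalBivariate_eq_zero
    intro x y _
    have := hsubst x (y - β * x)
    rw [h0, map_zero, add_sub_cancel] at this
    exact this.symm
  -- coefficients of `Q` are algebraic, and `Q(u n, v n - β u n) = 0`
  refine isAlgebraic_of_tendsto_of_eval₂_eq_zero_of_coeff Q hQ0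
    (fun i j => by rw [hQ]; exact isAlgebraic_coeff_coeff_map_map _ i j) hu hγ fun n => ?_
  change ev (u n) (v n - β * u n) Q = 0
  rw [hsubst, add_sub_cancel, ← hevQ]
  exact h n

end Literature.NumberTheory.Transcendental

end
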